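/-
Copyright: the b2b-balaban T⁴-continuum CRUX team, row NE7b OWNER lineage `t4-ne7b-p1` (gen 117). Project licence.
-/
import Summits.QuantumFields.BalabanUV.T4Continuum.Spine.NE7b.SupTorusActionMinimiser

/-!
# THE BLOCK-SPIN EFFECTIVE ACTION IS GLOBALLY STRONGLY CONVEX: for the torus action `S φ = ½Σ φ·(Rf(A(Ef φ))) + Σ v(φ x)` with
# `v′ = u`, `u′ ≥ −λ`, `λ < min(2,a)`, the constrained minimum `W(wt) = min {S φ : Q′t φ = wt}` ((93): attained, by exactly one
# field) obeys the SECANT LETTER `W(θw + (1−θ)w′) + ½(min(2,a) − λ)(n+1)^d·θ(1−θ)·Σ_y (w − w′)² ≤ θ·W(w) + (1−θ)·W(w′)` for all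
# coarse fields `w, w′` and `θ ∈ [0,1]` — modulus mesh-, volume- and dimension-free, ONE-sided curvature only (lattice `φ⁴_d` with
# `g ≥ 0`, `−m < min(2,a)` included); the global, derivative-free form of (90)∕(91)'s Hessian floor
# (row NE7b, node U5c; (92) first-order letter + (93) END + (89) block Jensen BY NAME; [folklore])

Cell `pub-balaban`, sub-cell `t4`, spine estimate NE7b (`T4WeightBudget.RelWeightBound`; the cell's OWN estimate — NOT PRINTED in
[Bałaban 1983–89], NOT PROVED).  Crux-route work under `Spine/NE7b/` by the row OWNER (`t4-ne7b-p1` gen 117) under FREEZE (0)'s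
crux-prover clause; NOTHING of Bałaban's is named as a Lean object, valued or asserted; no `T4Continuum/Support` leaf typed; no `def`,
no notation (the effective action is not introduced as an object: every statement quantifies over fields ON the fibres and over the
fibre minimiser); zero `sorry`.  Imports (BY NAME): the OWNER's (93) `…SupTorusActionMinimiser` (`existsUnique_torus_background`,
`existsUnique_phiFour_torus_background`, `hasDerivAt_phiFour_potential`; through it (92) `action_firstOrder_lower`, (89)
`torus_form_coercive` ∕ `blockVolume_mul_sum_sq_blockAvg_le`, TDF `torus_operator_form_symm`, INST `pairing_of_sitewise`, TEA
`fderiv_action_apply`, (86) `hasDerivAt_phiFour`).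

WHY (located).  (90)∕(91) floored the HESSIAN of the effective action at SBTL's small-field background — a local, second-order
statement inside the chart.  Convexity survives partial minimisation over an affine family: if `S` is `m`-strongly convex (secant form,
from (92)'s first-order letter by the two-point trick) and `φθ` minimises `S` on the fibre of `θw + (1−θ)w′`, then for ANY `φ, φ′` on
the fibres of `w, w′` the convex combination `θφ + (1−θ)φ′` lies on the fibre of `φθ`, so
`S φθ ≤ S(θφ + (1−θ)φ′) ≤ θ S φ + (1−θ) S φ′ − (m∕2)θ(1−θ)Σ(φ − φ′)²`, and block Jensen turns `Σ(φ − φ′)²` into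
`(n+1)^d Σ_y (w − w′)²`.  With (93) (the fibre minimum is attained at the unique solution of the sitewise equation) this is a statement
about backgrounds: THE EFFECTIVE ACTION OF A SEMICONVEX LATTICE THEORY UNDER THE BLOCK-AVERAGE CONSTRAINT IS STRONGLY CONVEX ON THE
WHOLE COARSE CARRIER, modulus `(min(2,a) − λ)(n+1)^d` — every mesh, period, dimension, and for `φ⁴` every coupling `g ≥ 0`.

WHAT IS PROVED ([folklore]):
* §1 (TEA's level: finite carrier `ι`, symmetric `At` with a form floor `γ`, `v′ = u`, `u′ ≥ −λ`) THE SECANT LETTER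
  **`action_secant_upper`** (`θ ∈ [0,1]`: `S(θφ + (1−θ)ψ) + ½(γ − λ)θ(1−θ)·Σ(φ − ψ)² ≤ θ·S φ + (1−θ)·S ψ`),
  **`fibreMin_secant_upper`** (ANY `Qt`, block Jensen `vol·Σ(Qt h)² ≤ Σ h²`, `λ ≤ γ`: if `φθ` minimises `S` on its fibre and
  `Qt φθ = θ·Qt φ + (1−θ)·Qt φ′`, then `S φθ + ½(γ − λ)θ(1−θ)·vol·Σ_y (Qt φ y − Qt φ′ y)² ≤ θ·S φ + (1−θ)·S φ′` — for ANY `φ, φ′`),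
  **`fibreCritical_firstOrder`** (the first-order letter of the fibre minimum: a pairing letter `DS(φ) = vol·⟨c, Qt –⟩` gives
  `S φ + vol·Σ c·(Qt φ′ − Qt φ) + ½(γ − λ)·vol·Σ(Qt φ′ − Qt φ)² ≤ S φ′` for ANY `φ′`), **`nextEquation_strongMonotone`** (two
  fibre-critical fields: `(γ − λ)·vol·Σ(Qt φ − Qt φ′)² ≤ vol·Σ (c − c′)·(Qt φ − Qt φ′)` — the next equation map is strongly monotone).
* §2 (the `Beta.Site` carriers, displayed actions; `u′ ≥ −λ` on `ℝ`, `λ < min(2,a)`) THE END **`torus_effectiveAction_secant`**: if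
  `φθ` solves the sitewise equation with torus block means `θ·wt + (1−θ)·wt′`, then for ALL fine torus fields `φ, φ′` with block means
  `wt, wt′`: `S φθ + ½(min(2,a) − λ)θ(1−θ)(n+1)^d·Σ_y (wt y − wt′ y)² ≤ θ·S φ + (1−θ)·S φ′`; **`torus_background_action_secant`** (the same
  between the three backgrounds of `wt`, `wt′`, `θwt + (1−θ)wt′`, which exist uniquely by (93)); **`torus_effectiveAction_firstOrder`**
  (INST's next-equation reading `λ` as the gradient: `S φt + (n+1)^d·Σ λ·(Q′t φ′ − Q′t φt) + ½(min(2,a) − λ)(n+1)^d·Σ(Q′t φ′ − Q′t φt)²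
  ≤ S φ′` for every `φ′`); **`torus_nextEquation_strongMonotone`** (THE RENORMALISED FIELD EQUATION IS A STRONGLY MONOTONE MAP OF THE
  BLOCK FIELD: `(min(2,a) − λ)(n+1)^d·Σ(w − w′)² ≤ (n+1)^d·Σ(λ − λ′)·(w − w′)`, modulus mesh- and volume-free).
* §3 **`phiFour_effectiveAction_secant`** (`u = g t³ + m t`, `0 ≤ g`, `−m < min(2,a)`).
* §4 toy.

HONEST (what this is NOT).  Finite-dimensional convex analysis on (92)∕(93); modulus OURS, not sharp, one-sided curvature only; the
secant letter is the derivative-free form — no `C²` statement about `W` is made here ((90)∕(91) have the Hessian at SBTL's background);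
no locality ∕ decay of the backgrounds (the sup road's business, two-sided letters); nothing about the fluctuation measure (a convex
effective ACTION is not yet a log-concave MARGINAL — that is the `…FluctuationStep*` road's Prékopa–Brascamp–Lieb statement, not
touched); cubic periods; scalar skeleton, hard constraint ((A3), NC-NE7b-α UNRULED); nothing of Bałaban's.  BY-NAME EFFECT ON THE WALL:
NONE.  NE7b NOT PRINTED ∕ NOT PROVED; spine PROVED 0∕9; rung (B)+1 on a FINITE torus — NOT infinite volume, NOT the mass gap, NOT Clay.
HONEST DEPENDENCY: continuum YM on T⁴ ⇐ BetaPertH ∧ nine spine estimates (0∕9 proved); BetaPertH ⇐ (D1) ∧ (D4) ∧ CAP+tail; G-an2-4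
gates asym, D1 and NE2∕3∕4.
-/

set_option autoImplicit false

noncomputable section

namespace Summit.QuantumFields.BalabanUV.T4Continuum.NE7b.SupTorusEffectiveActionConvex

open Set Function
open scoped ENNReal Topology
open Literature.MathematicalPhysics.QuantumFieldTheory.Balaban1983to89
open B6QGQLower276 (X blk B side AX)
open B5Hk103ScalarZd (nbhd)
open Beta (Site siteOf windowMap)
open SupTorusDirichletForm (torus_operator_form_symm)
open SupTorusDirichletFormCoercive (torus_form_coercive blockVolume_mul_sum_sq_blockAvg_le)
open SupTorusEffectiveAction (exists_clm_pair hasFDerivAt_action fderiv_action_apply)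
open SupTorusEffectiveActionInstance (pairing_of_sitewise)
open SupTorusActionConvex (action_firstOrder_lower)
open SupTorusActionMinimiser (existsUnique_torus_background hasDerivAt_phiFour_potential)
open SupPhiFourBackground (hasDerivAt_phiFour)

variable {d : ℕ}

/-! ## §1. TEA's level: the secant letter of the action and of the fibre minimum -/

section Generic

variable {ι κ : Type*} [Fintype ι]

/-- **THE SECANT LETTER OF THE ACTION** (strong convexity, two-point form): with a form floor `γ` for the symmetric `At`, `v′ = u`,
`u′ ≥ −λ`, and `θ ∈ [0,1]`: `S(θφ + (1−θ)ψ) + ½(γ − λ)θ(1−θ)·Σ_x (φ x − ψ x)² ≤ θ·S φ + (1−θ)·S ψ` ((92)'s first-order letter at the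
point `θφ + (1−θ)ψ` towards `φ` and towards `ψ`, weighted and added). [folklore] -/
theorem action_secant_upper (At : (ι → ℝ) →L[ℝ] (ι → ℝ))
    (hAt : ∀ φ ψ : ι → ℝ, ∑ x, ψ x * At φ x = ∑ x, φ x * At ψ x) {γ : ℝ}
    (hγ : ∀ h : ι → ℝ, γ * ∑ x, h x ^ 2 ≤ ∑ x, h x * At h x) {v u u' : ℝ → ℝ} (hv : ∀ t, HasDerivAt v (u t) t)
    (hu : ∀ t, HasDerivAt u (u' t) t) {lam : ℝ} (hu' : ∀ t, -lam ≤ u' t) {θ : ℝ} (hθ0 : 0 ≤ θ) (hθ1 : θ ≤ 1)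
    (φ ψ : ι → ℝ) :
    ((1 / 2 : ℝ) * ∑ x, (θ • φ + (1 - θ) • ψ) x * At (θ • φ + (1 - θ) • ψ) x + ∑ x, v ((θ • φ + (1 - θ) • ψ) x))
        + (γ - lam) / 2 * θ * (1 - θ) * ∑ x, (φ x - ψ x) ^ 2
      ≤ θ * ((1 / 2 : ℝ) * ∑ x, φ x * At φ x + ∑ x, v (φ x))
        + (1 - θ) * ((1 / 2 : ℝ) * ∑ x, ψ x * At ψ x + ∑ x, v (ψ x)) := by
  set ξ : ι → ℝ := θ • φ + (1 - θ) • ψ with hξ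
  have h1 := action_firstOrder_lower At hAt hγ hv hu hu' ξ φ
  have h2 := action_firstOrder_lower At hAt hγ hv hu hu' ξ ψ
  -- the linear terms cancel: `θ•(φ − ξ) + (1−θ)•(ψ − ξ) = 0`
  set D := fderiv ℝ (fun φ : ι → ℝ => (1 / 2 : ℝ) * ∑ x, φ x * At φ x + ∑ x, v (φ x)) ξ with hD
  have hlin : θ * D (φ - ξ) + (1 - θ) * D (ψ - ξ) = 0 := by
    have hzero : θ • (φ - ξ) + (1 - θ) • (ψ - ξ) = 0 := by
      rw [hξ]; ext x; simp; ring
    have h := congrArg D hzero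
    rw [map_add, map_smul, map_smul, map_zero, smul_eq_mul, smul_eq_mul] at h
    exact h
  -- the quadratic terms: `Σ(φ − ξ)² = (1−θ)²Σ(φ − ψ)²`, `Σ(ψ − ξ)² = θ²Σ(φ − ψ)²`
  have hq1 : ∑ x, (φ x - ξ x) ^ 2 = (1 - θ) ^ 2 * ∑ x, (φ x - ψ x) ^ 2 := by
    rw [Finset.mul_sum]
    exact Finset.sum_congr rfl fun x _ => by rw [hξ]; simp; ring
  have hq2 : ∑ x, (ψ x - ξ x) ^ 2 = θ ^ 2 * ∑ x, (φ x - ψ x) ^ 2 := by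
    rw [Finset.mul_sum]
    exact Finset.sum_congr rfl fun x _ => by rw [hξ]; simp; ring
  rw [hq1] at h1
  rw [hq2] at h2
  have h1' := mul_le_mul_of_nonneg_left h1 hθ0
  have h2' := mul_le_mul_of_nonneg_left h2 (sub_nonneg.2 hθ1)
  have hS : 0 ≤ ∑ x, (φ x - ψ x) ^ 2 := Finset.sum_nonneg fun x _ => sq_nonneg _
  nlinarith [h1', h2', hlin, hS]

variable [Fintype κ]

/-- **THE SECANT LETTER OF THE FIBRE MINIMUM** (partial minimisation over an affine family keeps strong convexity): ANY `Qt` with the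
block Jensen letter `vol·Σ_y (Qt h y)² ≤ Σ_x (h x)²`, `λ ≤ γ`, `θ ∈ [0,1]`; if `φθ` minimises `S` on its fibre and
`Qt φθ = θ·Qt φ + (1−θ)·Qt φ′`, then `S φθ + ½(γ − λ)θ(1−θ)·vol·Σ_y (Qt φ y − Qt φ′ y)² ≤ θ·S φ + (1−θ)·S φ′` — for ANY `φ, φ′`.
[folklore] -/
theorem fibreMin_secant_upper (At : (ι → ℝ) →L[ℝ] (ι → ℝ))
    (hAt : ∀ φ ψ : ι → ℝ, ∑ x, ψ x * At φ x = ∑ x, φ x * At ψ x) {γ : ℝ}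
    (hγ : ∀ h : ι → ℝ, γ * ∑ x, h x ^ 2 ≤ ∑ x, h x * At h x) {v u u' : ℝ → ℝ} (hv : ∀ t, HasDerivAt v (u t) t)
    (hu : ∀ t, HasDerivAt u (u' t) t) {lam : ℝ} (hu' : ∀ t, -lam ≤ u' t) (hγlam : lam ≤ γ)
    (Qt : (ι → ℝ) →L[ℝ] (κ → ℝ)) {vol : ℝ} (hJ : ∀ h : ι → ℝ, vol * ∑ y, Qt h y ^ 2 ≤ ∑ x, h x ^ 2)
    {θ : ℝ} (hθ0 : 0 ≤ θ) (hθ1 : θ ≤ 1) {φθ φ φ' : ι → ℝ} (hQ : Qt φθ = θ • Qt φ + (1 - θ) • Qt φ')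
    (hmin : IsMinOn (fun φ : ι → ℝ => (1 / 2 : ℝ) * ∑ x, φ x * At φ x + ∑ x, v (φ x)) {ψ | Qt ψ = Qt φθ} φθ) :
    ((1 / 2 : ℝ) * ∑ x, φθ x * At φθ x + ∑ x, v (φθ x))
        + (γ - lam) / 2 * θ * (1 - θ) * (vol * ∑ y, (Qt φ y - Qt φ' y) ^ 2)
      ≤ θ * ((1 / 2 : ℝ) * ∑ x, φ x * At φ x + ∑ x, v (φ x))
        + (1 - θ) * ((1 / 2 : ℝ) * ∑ x, φ' x * At φ' x + ∑ x, v (φ' x)) := by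
  -- the convex combination lies on the fibre of `φθ`
  have hmem : θ • φ + (1 - θ) • φ' ∈ {ψ : ι → ℝ | Qt ψ = Qt φθ} := by
    show Qt (θ • φ + (1 - θ) • φ') = Qt φθ
    rw [map_add, map_smul, map_smul, hQ]
  have hle := isMinOn_iff.1 hmin _ hmem
  have hsec := action_secant_upper At hAt hγ hv hu hu' hθ0 hθ1 φ φ'
  -- block Jensen on `φ − φ′`
  have hJ' : vol * ∑ y, (Qt φ y - Qt φ' y) ^ 2 ≤ ∑ x, (φ x - φ' x) ^ 2 := by
    have h := hJ (φ - φ')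
    simpa only [map_sub, Pi.sub_apply] using h
  have hcoef : 0 ≤ (γ - lam) / 2 * θ * (1 - θ) :=
    mul_nonneg (mul_nonneg (div_nonneg (sub_nonneg.2 hγlam) zero_le_two) hθ0) (sub_nonneg.2 hθ1)
  have h3 := mul_le_mul_of_nonneg_left hJ' hcoef
  linarith

/-- **THE FIRST-ORDER LETTER OF THE FIBRE MINIMUM** (the effective action's gradient is `vol·c`, TEA ∕ INST, made quantitative): if the
field equation at `φ` pairs like the block lift of `c` (`Σ_x ((At φ) x + u(φ x))·h x = vol·Σ_y c y·(Qt h) y`, the sitewise equation in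
pairing form), then for ANY `φ′`: `S φ + vol·Σ_y c y·(Qt φ′ − Qt φ) y + ½(γ − λ)·vol·Σ_y (Qt φ′ y − Qt φ y)² ≤ S φ′` (`λ ≤ γ`, block
Jensen). [folklore] -/
theorem fibreCritical_firstOrder (At : (ι → ℝ) →L[ℝ] (ι → ℝ))
    (hAt : ∀ φ ψ : ι → ℝ, ∑ x, ψ x * At φ x = ∑ x, φ x * At ψ x) {γ : ℝ}
    (hγ : ∀ h : ι → ℝ, γ * ∑ x, h x ^ 2 ≤ ∑ x, h x * At h x) {v u u' : ℝ → ℝ} (hv : ∀ t, HasDerivAt v (u t) t)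
    (hu : ∀ t, HasDerivAt u (u' t) t) {lam : ℝ} (hu' : ∀ t, -lam ≤ u' t) (hγlam : lam ≤ γ)
    (Qt : (ι → ℝ) →L[ℝ] (κ → ℝ)) {vol : ℝ} (hJ : ∀ h : ι → ℝ, vol * ∑ y, Qt h y ^ 2 ≤ ∑ x, h x ^ 2)
    {φ : ι → ℝ} {c : κ → ℝ} (hpair : ∀ h : ι → ℝ, ∑ x, (At φ x + u (φ x)) * h x = vol * ∑ y, c y * Qt h y) (φ' : ι → ℝ) :
    ((1 / 2 : ℝ) * ∑ x, φ x * At φ x + ∑ x, v (φ x)) + vol * ∑ y, c y * (Qt φ' y - Qt φ y)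
        + (γ - lam) / 2 * (vol * ∑ y, (Qt φ' y - Qt φ y) ^ 2)
      ≤ (1 / 2 : ℝ) * ∑ x, φ' x * At φ' x + ∑ x, v (φ' x) := by
  have h := action_firstOrder_lower At hAt hγ hv hu hu' φ φ'
  rw [fderiv_action_apply At hAt hv φ (φ' - φ), hpair (φ' - φ)] at h
  simp only [map_sub, Pi.sub_apply] at h
  have hJ' : vol * ∑ y, (Qt φ' y - Qt φ y) ^ 2 ≤ ∑ x, (φ' x - φ x) ^ 2 := by
    have h2 := hJ (φ' - φ)
    simpa only [map_sub, Pi.sub_apply] using h2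
  have h3 := mul_le_mul_of_nonneg_left hJ' (div_nonneg (sub_nonneg.2 hγlam) zero_le_two)
  linarith

/-- **THE NEXT EQUATION MAP IS STRONGLY MONOTONE** (TEA's level): two fibre-critical fields `φ, φ′` with multipliers `c, c′` (pairing
letters) satisfy `(γ − λ)·vol·Σ_y (Qt φ y − Qt φ′ y)² ≤ vol·Σ_y (c y − c′ y)·(Qt φ y − Qt φ′ y)` — the renormalised field equation
`w ↦ c(w)` is a strongly monotone map of the block field, modulus `γ − λ`. [folklore] -/
theorem nextEquation_strongMonotone (At : (ι → ℝ) →L[ℝ] (ι → ℝ))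
    (hAt : ∀ φ ψ : ι → ℝ, ∑ x, ψ x * At φ x = ∑ x, φ x * At ψ x) {γ : ℝ}
    (hγ : ∀ h : ι → ℝ, γ * ∑ x, h x ^ 2 ≤ ∑ x, h x * At h x) {v u u' : ℝ → ℝ} (hv : ∀ t, HasDerivAt v (u t) t)
    (hu : ∀ t, HasDerivAt u (u' t) t) {lam : ℝ} (hu' : ∀ t, -lam ≤ u' t) (hγlam : lam ≤ γ)
    (Qt : (ι → ℝ) →L[ℝ] (κ → ℝ)) {vol : ℝ} (hJ : ∀ h : ι → ℝ, vol * ∑ y, Qt h y ^ 2 ≤ ∑ x, h x ^ 2)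
    {φ φ' : ι → ℝ} {c c' : κ → ℝ} (hpair : ∀ h : ι → ℝ, ∑ x, (At φ x + u (φ x)) * h x = vol * ∑ y, c y * Qt h y)
    (hpair' : ∀ h : ι → ℝ, ∑ x, (At φ' x + u (φ' x)) * h x = vol * ∑ y, c' y * Qt h y) :
    (γ - lam) * (vol * ∑ y, (Qt φ y - Qt φ' y) ^ 2) ≤ vol * ∑ y, (c y - c' y) * (Qt φ y - Qt φ' y) := by
  have h1 := fibreCritical_firstOrder At hAt hγ hv hu hu' hγlam Qt hJ hpair φ'
  have h2 := fibreCritical_firstOrder At hAt hγ hv hu hu' hγlam Qt hJ hpair' φ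
  have hsq : ∑ y, (Qt φ' y - Qt φ y) ^ 2 = ∑ y, (Qt φ y - Qt φ' y) ^ 2 := Finset.sum_congr rfl fun y _ => by ring
  have hlin : vol * ∑ y, c y * (Qt φ' y - Qt φ y) + vol * ∑ y, c' y * (Qt φ y - Qt φ' y)
      = -(vol * ∑ y, (c y - c' y) * (Qt φ y - Qt φ' y)) := by
    rw [← mul_add, ← Finset.sum_add_distrib, ← mul_neg, ← Finset.sum_neg_distrib]
    congr 1
    exact Finset.sum_congr rfl fun y _ => by ring
  rw [hsq] at h1
  linarith

end Generic

/-! ## §2. The torus: the effective action is strongly convex on the whole coarse carrier -/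

section Torus

variable (n : ℕ) (a : ℝ) (s : ℕ) [NeZero s]
  {Dop Aop : lp (fun _ : X d => ℝ) ∞ →L[ℝ] lp (fun _ : X d => ℝ) ∞}
  (hD : ∀ (f : lp (fun _ : X d => ℝ) ∞) (y : X d), Dop f y = (((n : ℝ) + 1) ^ d)⁻¹ * ∑ p ∈ B n y, f p)
  (hA : ∀ (f : lp (fun _ : X d => ℝ) ∞) (p : X d), Aop f p = ∑ r ∈ nbhd n p, AX n a p r * f r)
  {v u u' : ℝ → ℝ} (hv : ∀ t, HasDerivAt v (u t) t) (hu : ∀ t, HasDerivAt u (u' t) t)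
  {lam : ℝ} (hu' : ∀ t, -lam ≤ u' t) (hγ : lam < min 2 a)
  {Ef : (Site d ((n + 1) * s) → ℝ) →L[ℝ] lp (fun _ : X d => ℝ) ∞}
  (hEf : ∀ (g : Site d ((n + 1) * s) → ℝ) (q : X d), Ef g q = g (siteOf d ((n + 1) * s) q))
  {Rf : lp (fun _ : X d => ℝ) ∞ →L[ℝ] (Site d ((n + 1) * s) → ℝ)}
  (hRf : ∀ (h : lp (fun _ : X d => ℝ) ∞) (x : Site d ((n + 1) * s)), Rf h x = h (windowMap d ((n + 1) * s) x))
  {Rc : lp (fun _ : X d => ℝ) ∞ →L[ℝ] (Site d s → ℝ)}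
  (hRc : ∀ (h : lp (fun _ : X d => ℝ) ∞) (x : Site d s), Rc h x = h (windowMap d s x))

include hD hA hv hu hu' hγ hEf hRf hRc in
/-- **THE END: THE SECANT LETTER OF THE TORUS EFFECTIVE ACTION.**  `u′ ≥ −λ` on `ℝ`, `λ < min(2,a)`, `θ ∈ [0,1]`: if the fine torus
field `φθ` solves the sitewise equation (SBTL's closed-ball letter) with torus block means `θ·wt + (1−θ)·wt′`, then for ALL fine torus
fields `φ, φ′` with block means `wt, wt′`:
`S φθ + ½(min(2,a) − λ)·θ(1−θ)·(n+1)^d·Σ_y (wt y − wt′ y)² ≤ θ·S φ + (1−θ)·S φ′` — every mesh `n`, period `s`, dimension `d`.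
[folklore] -/
theorem torus_effectiveAction_secant {θ : ℝ} (hθ0 : 0 ≤ θ) (hθ1 : θ ≤ 1) {wt wt' : Site d s → ℝ}
    {φθ : Site d ((n + 1) * s) → ℝ} (hQθ : ((Rc.comp Dop).comp Ef) φθ = θ • wt + (1 - θ) • wt')
    (heqθ : ∀ p : X d, Aop (Ef φθ) p + u (Ef φθ p)
      = (((n : ℝ) + 1) ^ d)⁻¹ * ∑ p' ∈ B n (blk n p), (Aop (Ef φθ) p' + u (Ef φθ p')))
    {φ φ' : Site d ((n + 1) * s) → ℝ} (hQ : ((Rc.comp Dop).comp Ef) φ = wt) (hQ' : ((Rc.comp Dop).comp Ef) φ' = wt') :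
    ((1 / 2 : ℝ) * ∑ x, φθ x * ((Rf.comp Aop).comp Ef) φθ x + ∑ x, v (φθ x))
        + (min 2 a - lam) / 2 * θ * (1 - θ) * (((n : ℝ) + 1) ^ d * ∑ y, (wt y - wt' y) ^ 2)
      ≤ θ * ((1 / 2 : ℝ) * ∑ x, φ x * ((Rf.comp Aop).comp Ef) φ x + ∑ x, v (φ x))
        + (1 - θ) * ((1 / 2 : ℝ) * ∑ x, φ' x * ((Rf.comp Aop).comp Ef) φ' x + ∑ x, v (φ' x)) := by
  have hmin := (existsUnique_torus_background n a s hD hA hEf hRf hRc hv hu hu' hγ (θ • wt + (1 - θ) • wt')).2 φθ hQθ heqθ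
  have hmin' : IsMinOn (fun φ : Site d ((n + 1) * s) → ℝ =>
      (1 / 2 : ℝ) * ∑ x, φ x * ((Rf.comp Aop).comp Ef) φ x + ∑ x, v (φ x))
      {ψ | ((Rc.comp Dop).comp Ef) ψ = ((Rc.comp Dop).comp Ef) φθ} φθ := by rw [hQθ]; exact hmin
  have hQcomb : ((Rc.comp Dop).comp Ef) φθ = θ • ((Rc.comp Dop).comp Ef) φ + (1 - θ) • ((Rc.comp Dop).comp Ef) φ' := by
    rw [hQ, hQ', hQθ]
  have h := fibreMin_secant_upper ((Rf.comp Aop).comp Ef) (torus_operator_form_symm n a s hA hEf hRf)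
    (torus_form_coercive n a s hA hEf hRf) hv hu hu' hγ.le ((Rc.comp Dop).comp Ef)
    (fun h => by simpa only [ContinuousLinearMap.comp_apply] using blockVolume_mul_sum_sq_blockAvg_le n s hD hEf hRc h)
    hθ0 hθ1 hQcomb hmin'
  rw [hQ, hQ'] at h
  exact h

include hD hA hv hu hu' hγ hEf hRf hRc in
/-- **BETWEEN THE BACKGROUNDS**: for coarse fields `wt, wt′` and `θ ∈ [0,1]`, the three fine torus fields solving the sitewise equation
with block means `wt`, `wt′`, `θwt + (1−θ)wt′` (each exists uniquely, (93)) satisfy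
`S φθ + ½(min(2,a) − λ)θ(1−θ)(n+1)^d·Σ_y (wt − wt′)² ≤ θ·S φ + (1−θ)·S φ′` — the effective action is strongly convex on the whole
coarse carrier. [folklore] -/
theorem torus_background_action_secant {θ : ℝ} (hθ0 : 0 ≤ θ) (hθ1 : θ ≤ 1) {wt wt' : Site d s → ℝ}
    {φθ φ φ' : Site d ((n + 1) * s) → ℝ} (hQθ : ((Rc.comp Dop).comp Ef) φθ = θ • wt + (1 - θ) • wt')
    (heqθ : ∀ p : X d, Aop (Ef φθ) p + u (Ef φθ p)
      = (((n : ℝ) + 1) ^ d)⁻¹ * ∑ p' ∈ B n (blk n p), (Aop (Ef φθ) p' + u (Ef φθ p')))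
    (hQ : ((Rc.comp Dop).comp Ef) φ = wt)
    (heq : ∀ p : X d, Aop (Ef φ) p + u (Ef φ p)
      = (((n : ℝ) + 1) ^ d)⁻¹ * ∑ p' ∈ B n (blk n p), (Aop (Ef φ) p' + u (Ef φ p')))
    (hQ' : ((Rc.comp Dop).comp Ef) φ' = wt')
    (heq' : ∀ p : X d, Aop (Ef φ') p + u (Ef φ' p)
      = (((n : ℝ) + 1) ^ d)⁻¹ * ∑ p' ∈ B n (blk n p), (Aop (Ef φ') p' + u (Ef φ' p'))) :
    ((1 / 2 : ℝ) * ∑ x, φθ x * ((Rf.comp Aop).comp Ef) φθ x + ∑ x, v (φθ x))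
        + (min 2 a - lam) / 2 * θ * (1 - θ) * (((n : ℝ) + 1) ^ d * ∑ y, (wt y - wt' y) ^ 2)
      ≤ θ * ((1 / 2 : ℝ) * ∑ x, φ x * ((Rf.comp Aop).comp Ef) φ x + ∑ x, v (φ x))
        + (1 - θ) * ((1 / 2 : ℝ) * ∑ x, φ' x * ((Rf.comp Aop).comp Ef) φ' x + ∑ x, v (φ' x)) := by
  -- `heq`, `heq′` are not needed for the inequality (ANY fields on the fibres do); they identify `φ, φ′` as THE backgrounds
  have _h1 := heq
  have _h2 := heq'
  exact torus_effectiveAction_secant n a s hD hA hv hu hu' hγ hEf hRf hRc hθ0 hθ1 hQθ heqθ hQ hQ'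

include hD hA hv hu hu' hγ hEf hRf hRc in
/-- **THE FIRST-ORDER LETTER OF THE TORUS EFFECTIVE ACTION**: if `φt` solves the sitewise equation, then for EVERY fine torus field
`φ′`, with `λ y := (n+1)^{−d}·Σ_{p′ ∈ B n (windowMap y)} ((A(Ef φt))(p′) + u((Ef φt)(p′)))` the torus reading of the next equation map
(INST): `S φt + (n+1)^d·Σ_y λ y·(Q′t φ′ − Q′t φt) y + ½(min(2,a) − λ)(n+1)^d·Σ_y (Q′t φ′ y − Q′t φt y)² ≤ S φ′`. [folklore] -/
theorem torus_effectiveAction_firstOrder (φt : Site d ((n + 1) * s) → ℝ)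
    (heq : ∀ p : X d, Aop (Ef φt) p + u (Ef φt p)
      = (((n : ℝ) + 1) ^ d)⁻¹ * ∑ p' ∈ B n (blk n p), (Aop (Ef φt) p' + u (Ef φt p')))
    (φ' : Site d ((n + 1) * s) → ℝ) :
    ((1 / 2 : ℝ) * ∑ x, φt x * ((Rf.comp Aop).comp Ef) φt x + ∑ x, v (φt x))
        + ((n : ℝ) + 1) ^ d * ∑ y : Site d s,
            ((((n : ℝ) + 1) ^ d)⁻¹ * ∑ p' ∈ B n (windowMap d s y), (Aop (Ef φt) p' + u (Ef φt p')))
              * (((Rc.comp Dop).comp Ef) φ' y - ((Rc.comp Dop).comp Ef) φt y)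
        + (min 2 a - lam) / 2
            * (((n : ℝ) + 1) ^ d * ∑ y, (((Rc.comp Dop).comp Ef) φ' y - ((Rc.comp Dop).comp Ef) φt y) ^ 2)
      ≤ (1 / 2 : ℝ) * ∑ x, φ' x * ((Rf.comp Aop).comp Ef) φ' x + ∑ x, v (φ' x) :=
  fibreCritical_firstOrder ((Rf.comp Aop).comp Ef) (torus_operator_form_symm n a s hA hEf hRf)
    (torus_form_coercive n a s hA hEf hRf) hv hu hu' hγ.le ((Rc.comp Dop).comp Ef)
    (fun h => by simpa only [ContinuousLinearMap.comp_apply] using blockVolume_mul_sum_sq_blockAvg_le n s hD hEf hRc h)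
    (pairing_of_sitewise n a s hD hA hEf hRf hRc φt u heq) φ'

include hD hA hv hu hu' hγ hEf hRf hRc in
/-- **THE TORUS NEXT EQUATION MAP IS STRONGLY MONOTONE, MESH- AND VOLUME-FREE**: two torus fields `φt, φt′` solving the sitewise equation,
with next-equation readings `λ, λ′` (INST's block means of the field equations) and block means `w = Q′t φt`, `w′ = Q′t φt′`, satisfy
`(min(2,a) − λ)·(n+1)^d·Σ_y (w − w′)² ≤ (n+1)^d·Σ_y (λ y − λ′ y)·(w − w′) y`. [folklore] -/
theorem torus_nextEquation_strongMonotone (φt φt' : Site d ((n + 1) * s) → ℝ)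
    (heq : ∀ p : X d, Aop (Ef φt) p + u (Ef φt p)
      = (((n : ℝ) + 1) ^ d)⁻¹ * ∑ p' ∈ B n (blk n p), (Aop (Ef φt) p' + u (Ef φt p')))
    (heq' : ∀ p : X d, Aop (Ef φt') p + u (Ef φt' p)
      = (((n : ℝ) + 1) ^ d)⁻¹ * ∑ p' ∈ B n (blk n p), (Aop (Ef φt') p' + u (Ef φt' p'))) :
    (min 2 a - lam) * (((n : ℝ) + 1) ^ d
        * ∑ y, (((Rc.comp Dop).comp Ef) φt y - ((Rc.comp Dop).comp Ef) φt' y) ^ 2)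
      ≤ ((n : ℝ) + 1) ^ d * ∑ y : Site d s,
          ((((n : ℝ) + 1) ^ d)⁻¹ * ∑ p' ∈ B n (windowMap d s y), (Aop (Ef φt) p' + u (Ef φt p'))
              - (((n : ℝ) + 1) ^ d)⁻¹ * ∑ p' ∈ B n (windowMap d s y), (Aop (Ef φt') p' + u (Ef φt' p')))
            * (((Rc.comp Dop).comp Ef) φt y - ((Rc.comp Dop).comp Ef) φt' y) :=
  nextEquation_strongMonotone ((Rf.comp Aop).comp Ef) (torus_operator_form_symm n a s hA hEf hRf)
    (torus_form_coercive n a s hA hEf hRf) hv hu hu' hγ.le ((Rc.comp Dop).comp Ef)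
    (fun h => by simpa only [ContinuousLinearMap.comp_apply] using blockVolume_mul_sum_sq_blockAvg_le n s hD hEf hRc h)
    (pairing_of_sitewise n a s hD hA hEf hRf hRc φt u heq) (pairing_of_sitewise n a s hD hA hEf hRf hRc φt' u heq')

end Torus

/-! ## §3. Lattice `φ⁴` -/

/-- **THE `φ⁴_d` EFFECTIVE ACTION IS STRONGLY CONVEX ON THE WHOLE COARSE CARRIER** (`u t = g t³ + m t`, `0 ≤ g`, `−m < min(2,a)`;
every side, period, dimension; ANY operators ∕ carrier maps with the displayed actions): if `φθ` solves the `φ⁴` sitewise equation with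
block means `θwt + (1−θ)wt′`, `θ ∈ [0,1]`, then for all fine fields `φ, φ′` with block means `wt, wt′`,
`S φθ + ½(min(2,a) + m)θ(1−θ)(n+1)^d·Σ_y (wt − wt′)² ≤ θ·S φ + (1−θ)·S φ′`, `S` the `φ⁴` torus action. [folklore] -/
theorem phiFour_effectiveAction_secant (n : ℕ) (a : ℝ) (s : ℕ) [NeZero s]
    {Dop Aop : lp (fun _ : X d => ℝ) ∞ →L[ℝ] lp (fun _ : X d => ℝ) ∞}
    (hD : ∀ (f : lp (fun _ : X d => ℝ) ∞) (y : X d), Dop f y = (((n : ℝ) + 1) ^ d)⁻¹ * ∑ p ∈ B n y, f p)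
    (hA : ∀ (f : lp (fun _ : X d => ℝ) ∞) (p : X d), Aop f p = ∑ r ∈ nbhd n p, AX n a p r * f r)
    {Ef : (Site d ((n + 1) * s) → ℝ) →L[ℝ] lp (fun _ : X d => ℝ) ∞}
    (hEf : ∀ (g : Site d ((n + 1) * s) → ℝ) (q : X d), Ef g q = g (siteOf d ((n + 1) * s) q))
    {Rf : lp (fun _ : X d => ℝ) ∞ →L[ℝ] (Site d ((n + 1) * s) → ℝ)}
    (hRf : ∀ (h : lp (fun _ : X d => ℝ) ∞) (x : Site d ((n + 1) * s)), Rf h x = h (windowMap d ((n + 1) * s) x))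
    {Rc : lp (fun _ : X d => ℝ) ∞ →L[ℝ] (Site d s → ℝ)}
    (hRc : ∀ (h : lp (fun _ : X d => ℝ) ∞) (x : Site d s), Rc h x = h (windowMap d s x))
    {g m : ℝ} (hg : 0 ≤ g) (hm : -m < min 2 a) {θ : ℝ} (hθ0 : 0 ≤ θ) (hθ1 : θ ≤ 1) {wt wt' : Site d s → ℝ}
    {φθ : Site d ((n + 1) * s) → ℝ} (hQθ : ((Rc.comp Dop).comp Ef) φθ = θ • wt + (1 - θ) • wt')
    (heqθ : ∀ p : X d, Aop (Ef φθ) p + (g * (Ef φθ p) ^ 3 + m * Ef φθ p)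
      = (((n : ℝ) + 1) ^ d)⁻¹ * ∑ p' ∈ B n (blk n p), (Aop (Ef φθ) p' + (g * (Ef φθ p') ^ 3 + m * Ef φθ p')))
    {φ φ' : Site d ((n + 1) * s) → ℝ} (hQ : ((Rc.comp Dop).comp Ef) φ = wt) (hQ' : ((Rc.comp Dop).comp Ef) φ' = wt') :
    ((1 / 2 : ℝ) * ∑ x, φθ x * ((Rf.comp Aop).comp Ef) φθ x + ∑ x, (g / 4 * (φθ x) ^ 4 + m / 2 * (φθ x) ^ 2))
        + (min 2 a + m) / 2 * θ * (1 - θ) * (((n : ℝ) + 1) ^ d * ∑ y, (wt y - wt' y) ^ 2)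
      ≤ θ * ((1 / 2 : ℝ) * ∑ x, φ x * ((Rf.comp Aop).comp Ef) φ x + ∑ x, (g / 4 * (φ x) ^ 4 + m / 2 * (φ x) ^ 2))
        + (1 - θ) * ((1 / 2 : ℝ) * ∑ x, φ' x * ((Rf.comp Aop).comp Ef) φ' x + ∑ x, (g / 4 * (φ' x) ^ 4 + m / 2 * (φ' x) ^ 2)) := by
  have h := torus_effectiveAction_secant n a s hD hA (v := fun t => g / 4 * t ^ 4 + m / 2 * t ^ 2)
    (u := fun t => g * t ^ 3 + m * t) (u' := fun t => 3 * g * t ^ 2 + m) (hasDerivAt_phiFour_potential g m)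
    (hasDerivAt_phiFour g m) (lam := -m) (fun t => by nlinarith [sq_nonneg t]) (by simpa using hm) hEf hRf hRc hθ0 hθ1 hQθ
    heqθ hQ hQ'
  simpa only [sub_neg_eq_add] using h

/-! ## §4. Toy -/

/-- Toy (§1 on one site): `At = 0` (floor `γ = 0`), `v = u = 0` (`u′ = 0 ≥ −0`), `θ = 1∕2`: the secant letter of the zero action. -/
example (φ ψ : Unit → ℝ) :
    ((1 / 2 : ℝ) * ∑ x, ((1 / 2 : ℝ) • φ + (1 - 1 / 2 : ℝ) • ψ) x * (0 : (Unit → ℝ) →L[ℝ] (Unit → ℝ)) ((1 / 2 : ℝ) • φ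
          + (1 - 1 / 2 : ℝ) • ψ) x + ∑ x, (fun _ : ℝ => (0 : ℝ)) (((1 / 2 : ℝ) • φ + (1 - 1 / 2 : ℝ) • ψ) x))
        + ((0 : ℝ) - 0) / 2 * (1 / 2 : ℝ) * (1 - 1 / 2) * ∑ x, (φ x - ψ x) ^ 2
      ≤ (1 / 2 : ℝ) * ((1 / 2 : ℝ) * ∑ x, φ x * (0 : (Unit → ℝ) →L[ℝ] (Unit → ℝ)) φ x + ∑ x, (fun _ : ℝ => (0 : ℝ)) (φ x))
        + (1 - 1 / 2 : ℝ) * ((1 / 2 : ℝ) * ∑ x, ψ x * (0 : (Unit → ℝ) →L[ℝ] (Unit → ℝ)) ψ x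
          + ∑ x, (fun _ : ℝ => (0 : ℝ)) (ψ x)) :=
  action_secant_upper (ι := Unit) 0 (fun _ _ => by simp) (γ := 0) (fun h => by simp) (v := fun _ => 0) (u := fun _ => 0)
    (u' := fun _ => 0) (fun t => by simpa using hasDerivAt_const t (0 : ℝ)) (fun t => by simpa using hasDerivAt_const t (0 : ℝ))
    (lam := 0) (fun _ => by norm_num) (by norm_num) (by norm_num) φ ψ

end Summit.QuantumFields.BalabanUV.T4Continuum.NE7b.SupTorusEffectiveActionConvex

end
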